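/-
Origin: expansion seat `planner-pub-hodgecm-pv14-g6-0`, handover import Pv14g6.SchwartzHyperbolicFlow -> import HodgeCM.Automorphic.SchwartzHyperbolicFlow (Mathlib.Analysis.SpecialFunctions.Exponential untouched) ; after t31 row 10 (SchwartzHyperbolicFlow) (`HOME/pub-hodgecm-pv14-g6/lean/Pv14g6/SchwartzExpFlow.lean`, md5 05abf31a, 233 lines);
landed by the gen-8 packager in gate run 31 as `HodgeCM/Automorphic/SchwartzExpFlow.lean` (import ^import Pv14g6\.SchwartzHyperbolicFlow[ \t]*$→import HodgeCM.Automorphic.SchwartzHyperbolicFlow ×1).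
-/
/-
Copyright: HodgeCM public adjudication package, seat pub-hodgecm-pv14-g6 (DAG-NODE PROVER #14, gen 6).
File #28 of this seat.  Kernel-checked, no new axioms.  Imports file #25 of this seat and Mathlib only.
-/
import Summits.HodgeConjecture.HodgeCM.Automorphic.SchwartzHyperbolicFlow
import Mathlib.Analysis.SpecialFunctions.Exponential

/-!
# Every linear one-parameter group `exp(sA)` is differentiable on Schwartz space

The capstone of this seat's flow calculus.  For a complete real normed space `E` and ANY continuous
linear `A : E →L[ℝ] E`, the operator exponential `exp(sA)` (Mathlib's `NormedSpace.exp`) is a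
one-parameter group of continuous linear automorphisms, `expFlow A s : E ≃L[ℝ] E`, with operator-norm
derivative `A` at `s = 0` (`hasDerivAt_coe_expFlow`, from Mathlib's `hasDerivAt_exp_smul_const'`).
Feeding this to the general engine of file #16 gives, for every Schwartz function `Φ` with values in
a real or complex normed space:

* `tendsto_compCLM_expFlow_sub_div_at` — `s⁻¹ • (Φ ∘ exp((s₀+s)A) - Φ ∘ exp(s₀A)) → flowGen A (Φ ∘ exp(s₀A))`
  in the Schwartz topology, at every `s₀`; the scalar coefficients `s ↦ T (Φ ∘ exp(sA))` are `C^∞`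
  (`contDiff_apply_compCLM_expFlow`) with the expected (iterated) derivatives;
* the complex-scalar forms `tendsto_compCLM_expFlow_sub_div_ofReal(_at)` — the literal shape
  `((s : ℂ))⁻¹ • (Φ ∘ exp(sA) - Φ) → flowGen A Φ` of the smooth-vector clauses;
* transport to any family with the same matrices: `eq_expFlow_of_coe_eq` and the `…_of_coe_eq_exp`
  corollaries.

The dilations of file #16 (`A = 1`), the hyperbolic rotations of file #25 (`A = J`, `J² = 1`) and any
Levi one-parameter subgroup are special cases.  Only published mathematics is used (Mathlib); nothing
here refers to the objects under adjudication.
-/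

noncomputable section

open Filter Topology
open scoped SchwartzMap ContDiff

namespace HodgeCM
namespace SchwartzWeil

/-! ## The operator exponential as a one-parameter group of automorphisms -/

section ExpFlow

variable {E : Type*} [NormedAddCommGroup E] [NormedSpace ℝ E] (A : E →L[ℝ] E)

/-- (Ported verbatim from the HodgeCMPerL package; no docstring in the source.) -/
private theorem mem_eball_expSeries_radius (T : E →L[ℝ] E) :
    T ∈ Metric.eball (0 : E →L[ℝ] E) (NormedSpace.expSeries ℝ (E →L[ℝ] E)).radius := by
  show edist T 0 < _
  rw [NormedSpace.expSeries_radius_eq_top]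
  exact edist_lt_top T 0

/-- `exp(sA)` as a continuous linear map. -/
def expCLM (s : ℝ) : E →L[ℝ] E := NormedSpace.exp (s • A)

/-- (Ported verbatim from the HodgeCMPerL package; no docstring in the source.) -/
theorem expCLM_def (s : ℝ) : expCLM A s = NormedSpace.exp (s • A) := rfl

/-- (Ported verbatim from the HodgeCMPerL package; no docstring in the source.) -/
theorem expCLM_zero : expCLM A 0 = 1 := by
  rw [expCLM, zero_smul, NormedSpace.exp_zero]

variable [CompleteSpace E]

/-- The group law `exp((s+t)A) = exp(sA) exp(tA)`. -/
theorem expCLM_add (s t : ℝ) : expCLM A (s + t) = expCLM A s * expCLM A t := by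
  unfold expCLM
  rw [add_smul]
  exact NormedSpace.exp_add_of_commute_of_mem_ball (((Commute.refl A).smul_left s).smul_right t)
    (mem_eball_expSeries_radius _) (mem_eball_expSeries_radius _)

/-- The one-parameter group `s ↦ exp(sA)` of continuous linear automorphisms (inverse `exp(-sA)`). -/
def expFlow (s : ℝ) : E ≃L[ℝ] E :=
  ContinuousLinearEquiv.unitsEquiv ℝ E
    ⟨expCLM A s, expCLM A (-s),
      by rw [← expCLM_add, add_neg_cancel, expCLM_zero],
      by rw [← expCLM_add, neg_add_cancel, expCLM_zero]⟩

/-- (Ported verbatim from the HodgeCMPerL package; no docstring in the source.) -/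
theorem coe_expFlow (s : ℝ) :
    ((expFlow A s : E ≃L[ℝ] E) : E →L[ℝ] E) = NormedSpace.exp (s • A) := by
  ext x
  rfl

/-- (Ported verbatim from the HodgeCMPerL package; no docstring in the source.) -/
theorem expFlow_apply (s : ℝ) (x : E) : expFlow A s x = NormedSpace.exp (s • A) x := rfl

/-- (Ported verbatim from the HodgeCMPerL package; no docstring in the source.) -/
theorem coe_expFlow_zero : ((expFlow A 0 : E ≃L[ℝ] E) : E →L[ℝ] E) = 1 := by
  rw [coe_expFlow, zero_smul, NormedSpace.exp_zero]

/-- (Ported verbatim from the HodgeCMPerL package; no docstring in the source.) -/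
theorem expFlow_zero_apply (x : E) : expFlow A 0 x = x := by
  rw [← ContinuousLinearEquiv.coe_coe, coe_expFlow_zero]; rfl

/-- (Ported verbatim from the HodgeCMPerL package; no docstring in the source.) -/
theorem expFlow_add_apply (s t : ℝ) (x : E) :
    expFlow A (s + t) x = expFlow A s (expFlow A t x) := by
  show expCLM A (s + t) x = expCLM A s (expCLM A t x)
  rw [expCLM_add]
  rfl

/-- **The operator-norm derivative of `s ↦ exp(sA)` at `0` is `A`.** -/
theorem hasDerivAt_coe_expFlow :
    HasDerivAt (fun s => ((expFlow A s : E ≃L[ℝ] E) : E →L[ℝ] E)) A 0 := by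
  have h := hasDerivAt_exp_smul_const' A (0 : ℝ)
  rw [zero_smul, NormedSpace.exp_zero, mul_one] at h
  exact h.congr_of_eventuallyEq (Eventually.of_forall fun s => coe_expFlow A s)

/-- At every parameter: `d/ds exp(sA) = A exp(s₀A)`. -/
theorem hasDerivAt_coe_expFlow_at (s₀ : ℝ) :
    HasDerivAt (fun s => ((expFlow A s : E ≃L[ℝ] E) : E →L[ℝ] E)) (A * NormedSpace.exp (s₀ • A)) s₀ :=
  (hasDerivAt_exp_smul_const' A s₀).congr_of_eventuallyEq
    (Eventually.of_forall fun s => coe_expFlow A s)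

end ExpFlow

/-! ## The flow `Φ ↦ Φ ∘ exp(sA)` on Schwartz space -/

section Schwartz

variable {E F G : Type*} [NormedAddCommGroup E] [NormedSpace ℝ E] [CompleteSpace E]
  [NormedAddCommGroup F] [NormedSpace ℝ F] [NormedAddCommGroup G] [NormedSpace ℝ G]
variable (𝕜 : Type*) [RCLike 𝕜] [NormedSpace 𝕜 F] [SMulCommClass ℝ 𝕜 F]
variable (A : E →L[ℝ] E)

/-- **`exp(sA)` is differentiable in the Schwartz topology, at every base point, for every `A`**:
`s⁻¹ • (Φ ∘ exp((s₀+s)A) - Φ ∘ exp(s₀A)) → flowGen A (Φ ∘ exp(s₀A))` in `𝓢(E, F)`. -/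
theorem tendsto_compCLM_expFlow_sub_div_at (Φ : 𝓢(E, F)) (s₀ : ℝ) :
    Tendsto (fun s : ℝ => s⁻¹ • (SchwartzMap.compCLMOfContinuousLinearEquiv 𝕜 (expFlow A (s₀ + s)) Φ
        - SchwartzMap.compCLMOfContinuousLinearEquiv 𝕜 (expFlow A s₀) Φ)) (𝓝[≠] 0)
      (𝓝 (flowGen A (SchwartzMap.compCLMOfContinuousLinearEquiv 𝕜 (expFlow A s₀) Φ))) :=
  tendsto_compCLM_sub_div_at 𝕜 (coe_expFlow_zero A) (hasDerivAt_coe_expFlow A) (expFlow_add_apply A)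
    Φ s₀

/-- At `s₀ = 0`: `s⁻¹ • (Φ ∘ exp(sA) - Φ) → flowGen A Φ`. -/
theorem tendsto_compCLM_expFlow_sub_div (Φ : 𝓢(E, F)) :
    Tendsto (fun s : ℝ => s⁻¹ • (SchwartzMap.compCLMOfContinuousLinearEquiv 𝕜 (expFlow A s) Φ - Φ))
      (𝓝[≠] 0) (𝓝 (flowGen A Φ)) :=
  tendsto_compCLM_sub_div 𝕜 (coe_expFlow_zero A) (hasDerivAt_coe_expFlow A) Φ

/-- Scalar coefficients `s ↦ T (Φ ∘ exp(sA))` are differentiable with derivative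
`T (flowGen A (Φ ∘ exp(s₀A)))`. -/
theorem hasDerivAt_apply_compCLM_expFlow (T : 𝓢(E, F) →L[ℝ] G) (Φ : 𝓢(E, F)) (s₀ : ℝ) :
    HasDerivAt (fun s => T (SchwartzMap.compCLMOfContinuousLinearEquiv 𝕜 (expFlow A s) Φ))
      (T (flowGen A (SchwartzMap.compCLMOfContinuousLinearEquiv 𝕜 (expFlow A s₀) Φ))) s₀ :=
  hasDerivAt_apply_compCLM 𝕜 T (coe_expFlow_zero A) (hasDerivAt_coe_expFlow A)
    (expFlow_add_apply A) Φ s₀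

/-- Scalar coefficients `s ↦ T (Φ ∘ exp(sA))` are `C^∞` on `ℝ`. -/
theorem contDiff_apply_compCLM_expFlow (T : 𝓢(E, F) →L[ℝ] G) (Φ : 𝓢(E, F)) :
    ContDiff ℝ ∞ (fun s : ℝ => T (SchwartzMap.compCLMOfContinuousLinearEquiv 𝕜 (expFlow A s) Φ)) :=
  contDiff_apply_compCLM 𝕜 T (coe_expFlow_zero A) (hasDerivAt_coe_expFlow A) (expFlow_add_apply A) Φ

/-- Their iterated derivatives: `(d/ds)^k T (Φ ∘ exp(sA)) = T ((flowGen A)^k (Φ ∘ exp(sA)))`. -/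
theorem iteratedDeriv_apply_compCLM_expFlow (T : 𝓢(E, F) →L[ℝ] G) (Φ : 𝓢(E, F)) (k : ℕ) :
    iteratedDeriv k (fun s : ℝ => T (SchwartzMap.compCLMOfContinuousLinearEquiv 𝕜 (expFlow A s) Φ))
      = fun s => T ((flowGen A)^[k] (SchwartzMap.compCLMOfContinuousLinearEquiv 𝕜 (expFlow A s) Φ)) :=
  iteratedDeriv_apply_compCLM 𝕜 T (coe_expFlow_zero A) (hasDerivAt_coe_expFlow A)
    (expFlow_add_apply A) Φ k

end Schwartz

/-! ## Complex-scalar forms -/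

section Complex

variable {E F : Type*} [NormedAddCommGroup E] [NormedSpace ℝ E] [CompleteSpace E]
  [NormedAddCommGroup F] [NormedSpace ℝ F] [NormedSpace ℂ F] [IsScalarTower ℝ ℂ F]
  [SMulCommClass ℝ ℂ F]
variable (A : E →L[ℝ] E)

/-- **`exp(sA)` with complex scalars, at every base point.** -/
theorem tendsto_compCLM_expFlow_sub_div_ofReal_at (Φ : 𝓢(E, F)) (s₀ : ℝ) :
    Tendsto (fun s : ℝ => ((s : ℂ))⁻¹
        • (SchwartzMap.compCLMOfContinuousLinearEquiv ℂ (expFlow A (s₀ + s)) Φ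
          - SchwartzMap.compCLMOfContinuousLinearEquiv ℂ (expFlow A s₀) Φ)) (𝓝[≠] 0)
      (𝓝 (flowGen A (SchwartzMap.compCLMOfContinuousLinearEquiv ℂ (expFlow A s₀) Φ))) :=
  tendsto_compCLM_sub_div_at_ofReal (coe_expFlow_zero A) (hasDerivAt_coe_expFlow A)
    (expFlow_add_apply A) Φ s₀

/-- **`exp(sA)` with complex scalars at `0` — the literal smooth-vector-clause shape**, for EVERY
continuous linear `A`: `((s : ℂ))⁻¹ • (Φ ∘ exp(sA) - Φ) → flowGen A Φ` in `𝓢(E, F)`. -/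
theorem tendsto_compCLM_expFlow_sub_div_ofReal (Φ : 𝓢(E, F)) :
    Tendsto (fun s : ℝ => ((s : ℂ))⁻¹
        • (SchwartzMap.compCLMOfContinuousLinearEquiv ℂ (expFlow A s) Φ - Φ)) (𝓝[≠] 0)
      (𝓝 (flowGen A Φ)) :=
  tendsto_compCLM_sub_div_ofReal (coe_expFlow_zero A) (hasDerivAt_coe_expFlow A) Φ

end Complex

/-! ## Transport to any family with the same matrices -/

section Transport

variable {E F : Type*} [NormedAddCommGroup E] [NormedSpace ℝ E] [CompleteSpace E]
  [NormedAddCommGroup F] [NormedSpace ℝ F]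
variable {A : E →L[ℝ] E} {g : ℝ → (E ≃L[ℝ] E)}

/-- A family of continuous linear automorphisms with matrices `exp(sA)` is `expFlow A`. -/
theorem eq_expFlow_of_coe_eq (hg : ∀ s, ((g s : E ≃L[ℝ] E) : E →L[ℝ] E) = NormedSpace.exp (s • A)) :
    g = expFlow A := by
  funext s
  refine ContinuousLinearEquiv.ext ?_
  have h : ((g s : E ≃L[ℝ] E) : E →L[ℝ] E) = ((expFlow A s : E ≃L[ℝ] E) : E →L[ℝ] E) := by
    rw [hg s, coe_expFlow]
  exact congrArg (fun T : E →L[ℝ] E => (T : E → E)) h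

variable (hg : ∀ s, ((g s : E ≃L[ℝ] E) : E →L[ℝ] E) = NormedSpace.exp (s • A))
include hg

/-- Real or complex scalars, every base point, for any family with matrices `exp(sA)`. -/
theorem tendsto_compCLM_sub_div_at_of_coe_eq_exp (𝕜 : Type*) [RCLike 𝕜] [NormedSpace 𝕜 F]
    [SMulCommClass ℝ 𝕜 F] (Φ : 𝓢(E, F)) (s₀ : ℝ) :
    Tendsto (fun s : ℝ => s⁻¹ • (SchwartzMap.compCLMOfContinuousLinearEquiv 𝕜 (g (s₀ + s)) Φ
        - SchwartzMap.compCLMOfContinuousLinearEquiv 𝕜 (g s₀) Φ)) (𝓝[≠] 0)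
      (𝓝 (flowGen A (SchwartzMap.compCLMOfContinuousLinearEquiv 𝕜 (g s₀) Φ))) := by
  rw [eq_expFlow_of_coe_eq hg]
  exact tendsto_compCLM_expFlow_sub_div_at 𝕜 A Φ s₀

/-- Scalar coefficients along any family with matrices `exp(sA)` are `C^∞`. -/
theorem contDiff_apply_compCLM_of_coe_eq_exp (𝕜 : Type*) [RCLike 𝕜] [NormedSpace 𝕜 F]
    [SMulCommClass ℝ 𝕜 F] {G : Type*} [NormedAddCommGroup G] [NormedSpace ℝ G]
    (T : 𝓢(E, F) →L[ℝ] G) (Φ : 𝓢(E, F)) :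
    ContDiff ℝ ∞ (fun s : ℝ => T (SchwartzMap.compCLMOfContinuousLinearEquiv 𝕜 (g s) Φ)) := by
  rw [eq_expFlow_of_coe_eq hg]
  exact contDiff_apply_compCLM_expFlow 𝕜 A T Φ

/-- **Complex scalars at `0`, for any family with matrices `exp(sA)`**:
`((s : ℂ))⁻¹ • (Φ ∘ g s - Φ) → flowGen A Φ`. -/
theorem tendsto_compCLM_sub_div_ofReal_of_coe_eq_exp [NormedSpace ℂ F] [IsScalarTower ℝ ℂ F]
    [SMulCommClass ℝ ℂ F] (Φ : 𝓢(E, F)) :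
    Tendsto (fun s : ℝ => ((s : ℂ))⁻¹
        • (SchwartzMap.compCLMOfContinuousLinearEquiv ℂ (g s) Φ - Φ)) (𝓝[≠] 0)
      (𝓝 (flowGen A Φ)) := by
  rw [eq_expFlow_of_coe_eq hg]
  exact tendsto_compCLM_expFlow_sub_div_ofReal A Φ

end Transport

end SchwartzWeil
end HodgeCM
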